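import Literature.MathematicalPhysics.PowerSystems.DenseKuramotoNetworkSynchronization
import HarnessLib

/-!
# The finite-`N` all-to-all Kuramoto model with ARBITRARY natural frequencies: a locked state has a
# negative semi-definite Jacobian ⇔ `κᵢ = Σⱼ cos(θⱼ − θᵢ) > 0` for every oscillator and
# `τ = Σᵢ 1/κᵢ ≤ 2` (Bronski–DeVille–Park 2012, Theorem 2.2 — the index theorem — in its stable case,
# with Prop. 2.1, Def. 2.4 / Remark 2.2 and Lemma 2.4), both stability notions, and the swing twin

Topic `Literature/MathematicalPhysics/PowerSystems`, namespaces
`Literature.MathematicalPhysics.PowerSystems.NonuniformKuramoto` (first-order model `NonuniformKuramoto n`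
of `NonuniformKuramotoPhaseCohesiveness.lean`, its `classic N K ω` normalisation, the state-dependent
Laplacian `toDroopNetwork.lap θ` of `KuramotoSyncExponentialStability.lean`) and
`…ClassicalModel.LosslessSystem` (damped swing model of `LosslessMultimachineRegionOfAttraction.lean`).
Records and bridges used UNCHANGED. Everything below is PROVED: no definition, no named fact, no new
axiom, no `sorry`.

WHY. `CompleteNetworkUniqueStableState.lean` (Taylor 2012 Thm 4.1) settles the complete network with
IDENTICAL natural frequencies: the in-phase state is the only stable locked state. With HETEROGENEOUS
frequencies `ω` the locked states spread over the circle and the question «which locked states are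
stable» has a closed-form answer, found by R. Mirollo and S. Strogatz (2005, spectrum of the locked
state) and put in final form by J. C. Bronski, L. DeVille and M. J. Park (2012) as an INDEX THEOREM:
the Jacobian `J(θ)` at ANY configuration is a rank-two perturbation `−D + v⊗v + w⊗w` of the diagonal
matrix `Dᵢᵢ = κᵢ = Σⱼ cos(θⱼ − θᵢ)`, and `n₊(J) = n₊(−D) + [τ > 2]` with `τ = Σᵢ 1/κᵢ`. Its stable
case `n₊(J) = 0` is the statement typed here, as an `iff` that is hypothesis-free in `θ` and `ω`.

SOURCE (read on the page; held LaTeX `lit read arxiv:1111.5302`). J. C. Bronski, L. DeVille,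
M. J. Park, *Fully synchronous solutions and the synchronization phase transition for the finite-N
Kuramoto model*, Chaos **22** (2012) 033133 [BronskiDeVillePark2012]: §1 model (eq:K)
`θ̇ᵢ = ωᵢ + γ Σⱼ sin(θⱼ − θᵢ)`, `fᵢ(θ) = Σⱼ sin(θⱼ − θᵢ)` (p0003 L76–L82), Definition 1.1 («fully
synchronous»: a stationary solution with `J` «negative semi-definite with a one-dimensional kernel»,
p0003 L140–p0004 L9); §2.1 `Σᵢ fᵢ(θ) = 0` (p0005 L14–L20), Definition 2.1 (`𝒮_θ`, p0005 L44–L52);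
§2.2 eq. (J) `Jᵢⱼ = cos(θᵢ − θⱼ)` (`i ≠ j`), `Jᵢᵢ = −Σ_{k≠i} cos(θₖ − θᵢ)`, eq. (rank2)
`J = −D + v⊗v + w⊗w`, `v = (sin θᵢ)`, `w = (cos θᵢ)`, `Dᵢᵢ = Σₖ cos(θₖ − θᵢ)` (p0005 L97–L128);
**Proposition 2.1** «rotate the configuration so that the order parameter is on the positive real
axis. Then `n₊(−D) = #{θᵢ | cos(θᵢ) < 0}`» with proof «`Dᵢᵢ = cos(θᵢ)Σₖ cos(θₖ) + sin(θₖ)Σ sin(θᵢ)`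
… the `(1,0)` component of the order parameter rotated through angle `θᵢ`» (p0005 L150–p0006 L12);
Remark 2.1 (= §4 of Mirollo–Strogatz 2005); **Theorem 2.2** «Suppose `D` is invertible. Define
`τ = Σᵢ 1/Σⱼ cos(θⱼ − θᵢ) = ⟨v, D⁻¹v⟩ + ⟨w, D⁻¹w⟩ = ⟨𝟙, D⁻¹𝟙⟩`. Then `n₊(J) = n₊(−D) + {0, τ < 2;
1, τ > 2}`» with its Birman–Schwinger proof (p0006 L22–L100); Lemma 2.3 (`𝒮_θ` = the component of
`τ⁻¹([1,2))` containing the origin, p0007 L1–L35); **Definition 2.4** «`κᵢ(θ) = Σⱼ cos(θⱼ − θᵢ)`.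
Define `𝒮_θ` as the subset of `𝕋ⁿ` for which we have `κᵢ ≥ 0` and `τ = Σ κᵢ⁻¹ ≤ 2`» and **Remark 2.2**
«by Proposition 2.1 and Theorem 2.2, `𝒮_ω` is precisely the set of `ω` such that `ω = f(θ)` for some
`θ`, and the Jacobian (rank2) is negative semi-definite» (p0007 L44–L54); **Lemma 2.4** (k1)
`κᵢ² + ωᵢ² = Σⱼ κⱼ`, (k2) `κᵢ > 0`, (k3) `Σ 1/κᵢ < 2`, (k4) `Σωᵢ = 0`, «(k2) implies `κᵢ > 1/2`»,
«`|κ − N𝟙|² + ω² = N³/4` and thus the entire stable region lies in a sphere of radius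
`‖ω‖ ≤ N^{3/2}/2`», proof's first display `κᵢ² + ωᵢ² = Σ_{j,j'} cos(θⱼ − θⱼ')` (p0007 L62–L97).

WHAT IS PROVED (with `κᵢ(θ) := Σⱼ cos(θᵢ − θⱼ)`, `σᵢ(θ) := Σⱼ sin(θᵢ − θⱼ) = −fᵢ(θ)`,
`Q(u) := Σᵢ uᵢ Σⱼ cos(θᵢ − θⱼ)(uᵢ − uⱼ) = −uᵀJu`, `τ := Σᵢ 1/κᵢ`, all spelled out in the statements):
* §1 `rowSum_cos_eq`, `rowSum_sin_eq` (Prop. 2.1's identity `κᵢ = a cos θᵢ + b sin θᵢ`,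
  `σᵢ = a sin θᵢ − b cos θᵢ`, `a + ib = Σ e^{iθⱼ}`), `sum_rowSum_sin_eq_zero` (`Σ f = 0`),
  `rowSum_cos_sq_add_rowSum_sin_sq(')` (`κᵢ² + σᵢ² = a² + b² = Σⱼ κⱼ`, the heart of Lemma 2.4),
  `rowSum_cos_eq_of_centred`, `rowSum_cos_neg_iff_of_centred` (Prop. 2.1: sign `κᵢ` = sign `cos θᵢ`
  in the frame of the order parameter).
* §2 `allToAll_linForm_eq` (eq. (rank2): `Q(u) = Σκᵢuᵢ² − ⟨w,u⟩² − ⟨v,u⟩²`), `allToAll_linForm_mul_eq`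
  (`(Σκ)Q(u) = (Σκ)Σκᵢuᵢ² − ⟨κ,u⟩² − ⟨σ,u⟩²`), `allToAll_linForm_single` (`Q(eᵢ) = κᵢ − 1 = −Jᵢᵢ`),
  `sum_rowSum_sin_sq_div_eq` (`T := Σσᵢ²/κᵢ = (Σκ)(τ − 1)`), `sq_sum_rowSum_sin_mul_le` (weighted
  Cauchy–Schwarz `⟨σ,v⟩² ≤ T Σκᵢvᵢ²`), `allToAll_linForm_centred_eq` (`(Σκ)Q(u) = (Σκ)Σκᵢvᵢ² − ⟨σ,v⟩²`,
  `v = u − (⟨κ,u⟩/Σκ)𝟙`).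
* §3 **THE CRITERION** `allToAll_linForm_witness_eq` (`(Σκ)Q(σ/κ) = T(Σκ − T)`),
  `allToAll_linForm_nonneg_of_tau_le_two`, `allToAll_linForm_ker_of_tau_lt_two`,
  `one_le_rowSum_cos_of_allToAll_linForm_nonneg` (NSD ⇒ `κᵢ ≥ 1`: `n₊(−D) = 0`),
  `tau_le_two_of_allToAll_linForm_nonneg`, ★★★ **`allToAll_linForm_nonneg_iff`**
  (`Q ≥ 0 ⇔ (∀ i, κᵢ > 0) ∧ τ ≤ 2`), ★★ **`allToAll_linForm_posDef_iff`** (`Q ≥ 0` with kernel the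
  constants `⇔ (∀ i, κᵢ > 0) ∧ τ < 2` — Def. 2.1 / Lemma 2.4 (k2)(k3)), `rowSum_cos_gt_half_of_tau_lt_two`.
* §4 `linForm_complete_eq` (+ private `linForm_eq_half_sum_sq`, `complete_weights_symm`),
  `stabilityMatrix_negSemidef_iff_linForm_nonneg`, `stabilityMatrix_negDef_iff_linForm_pos` (the
  print's matrix notions ↔ the tree's real forms).
* §5 MODEL (non-uniform first-order Kuramoto, lossless, `Pᵢⱼ = k > 0` for `i ≠ j`, ANY `ω`, `Dᵢ > 0`):
  ★★★ **`complete_stabilityMatrix_negSemidef_iff`** (`−L(θ)` NSD ⇔ criterion, every `θ`),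
  ★★ `complete_stabilityMatrix_negDef_iff` (ND off `𝟙` ⇔ strict criterion),
  ★★ `complete_criterion_of_lockedSolution_stable` (LYAPUNOV-stable locked solution ⇒ criterion),
  ★★ `complete_lockedSolution_locally_expStable_of_tau_lt_two`, `complete_lockedSolution_stable_of_tau_lt_two`
  (strict criterion ⇒ locally exponentially stable modulo rotation ⇒ Lyapunov-stable).
* §6 `complete_locked_rowSum_sin_eq` (`kσᵢ = ωᵢ − DᵢΩ` at a locked state), ★ `complete_locked_sq_identity`
  (Lemma 2.4 (k1)), ★ `complete_locked_sphere` (`Σ(κᵢ − N/2)² + Σω̃ᵢ² = N³/4`), ★ `complete_locked_freq_sq_le`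
  (`Σᵢ(ωᵢ − DᵢΩ)² ≤ k²N³/4` at EVERY locked state — an ℓ² necessary condition for locking).
* §7 classic normalisation `classic N K ω` (`γ = K/N`): `classic_stabilityMatrix_negSemidef_iff`,
  `classic_stabilityMatrix_negDef_iff`, `classic_criterion_of_lockedSolution_stable`,
  `classic_lockedSolution_stable_of_tau_lt_two`, `classic_locked_freq_sq_le` (`Σ(ωᵢ − Ω)² ≤ K²N/4`).
* §8 SWING TWIN (`ClassicalModel.LosslessSystem n 0`, `Cᵢⱼ = k > 0` off the diagonal, any injections,
  `Mᵢ, Dᵢ > 0`): ★★ `complete_criterion_of_stable_syncSolution` (Lyapunov-stable synchronous solution ⇒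
  criterion), ★★ `complete_stable_syncSolution_of_tau_lt_two` (strict criterion ⇒ stable and attracting
  in the co-rotating frame).

PROOF ROUTE (documented deviation). The print proves Theorem 2.2 by a Birman–Schwinger homotopy
`J_η = −D + η(v⊗v + w⊗w)` and a `2×2` determinant; the stable case is typed here by an elementary route
on the same objects: in the rotated coordinates `(κ, σ)` (Prop. 2.1) one has `(Σκ)Q(u) =
(Σκ)Σκᵢvᵢ² − ⟨σ,v⟩²` after centring along `𝟙`, the weighted Cauchy–Schwarz inequality gives
`(Σκ)Q ≥ (Σκ − T)Σκᵢvᵢ²` with `T = Σσᵢ²/κᵢ = (Σκ)(τ − 1)`, and the two test vectors `eᵢ`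
(`Q = κᵢ − 1`) and `σ/κ` (`(Σκ)Q = T(Σκ − T)`) give necessity; at `τ = 2` the vector `σ/κ` is a second
kernel direction. The index count for `n₊ > 0` (unstable states) is NOT typed (no inertia theory is
needed for the stability criterion); `κᵢ = 0` is excluded explicitly (the print's `κᵢ ≥ 0` in Def. 2.4
is immaterial there since `τ = +∞`; here `1/0 = 0` would make it material, and indeed NSD forces
`κᵢ ≥ 1`).

THREE COLUMNS. CERTIFIED: kernel theorems; for a typed network and a locked state given by exact data
the criterion is `N + 1` rational/algebraic inequalities. MODELLED: first-order Kuramoto / classic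
Kuramoto / damped swing model on the uniform complete lossless network. NOT CLAIMED: the index formula
for unstable states, Lemma 2.3 (simple connectedness), Theorem 2.5 (convexity of `𝒮_ω`), §§3–4
(extremal frequency vectors, large-`N` asymptotics), anything for non-uniform weights (see
`DenseKuramotoNetworkSynchronization.lean`, `KuramotoCutsetStabilityNecessity.lean`), and the
boundary `τ = 2` in the Lyapunov reading (linearisation is silent there).
-/

noncomputable section

open Real Set Filter Topology Metric Finset
open scoped Matrix

namespace Literature.MathematicalPhysics.PowerSystems

namespace NonuniformKuramoto

variable {n : ℕ} (k : ℝ)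

/-! ### §1. The row sums `κᵢ`, `σᵢ` and the order parameter (BDP Prop. 2.1) -/

/-- `κᵢ(θ) := Σⱼ cos(θᵢ − θⱼ) = a cos θᵢ + b sin θᵢ` with `a + ib = Σⱼ e^{iθⱼ}` the (unnormalised)
complex order parameter: `κᵢ` is «the `(1,0)` component of the order parameter rotated through angle
`θᵢ`», i.e. `κᵢ = N R cos(θᵢ − ψ)`. [cite: BronskiDeVillePark2012, §2.2 Prop. 2.1 and its proof (arXiv:1111.5302 p0005–p0006)] -/
theorem rowSum_cos_eq (θ : Fin n → ℝ) (i : Fin n) :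
    ∑ j, Real.cos (θ i - θ j)
      = (∑ j, Real.cos (θ j)) * Real.cos (θ i) + (∑ j, Real.sin (θ j)) * Real.sin (θ i) := by
  simp only [Real.cos_sub]
  rw [Finset.sum_mul, Finset.sum_mul, ← Finset.sum_add_distrib]
  exact Finset.sum_congr rfl fun j _ => by ring

/-- `σᵢ(θ) := Σⱼ sin(θᵢ − θⱼ) = a sin θᵢ − b cos θᵢ` (`= −fᵢ(θ)`, the coupling term of the model
`θ̇ = ω + γ f(θ)`, `fᵢ(θ) = Σⱼ sin(θⱼ − θᵢ)`). [cite: BronskiDeVillePark2012, §2.1 eq. (Kvec), §1 eq. for `fᵢ` (arXiv:1111.5302 p0003, p0005)] -/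
theorem rowSum_sin_eq (θ : Fin n → ℝ) (i : Fin n) :
    ∑ j, Real.sin (θ i - θ j)
      = (∑ j, Real.cos (θ j)) * Real.sin (θ i) - (∑ j, Real.sin (θ j)) * Real.cos (θ i) := by
  simp only [Real.sin_sub]
  rw [Finset.sum_mul, Finset.sum_mul, ← Finset.sum_sub_distrib]
  exact Finset.sum_congr rfl fun j _ => by ring

/-- `Σᵢ σᵢ(θ) = 0` («`Σᵢ fᵢ(θ) = 0` for all `θ`, due to a telescoping sum»).
[cite: BronskiDeVillePark2012, §2.1 (arXiv:1111.5302 p0005 L14–L20)] -/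
theorem sum_rowSum_sin_eq_zero (θ : Fin n → ℝ) : ∑ i, ∑ j, Real.sin (θ i - θ j) = 0 := by
  simp only [rowSum_sin_eq θ]
  rw [Finset.sum_sub_distrib, ← Finset.mul_sum, ← Finset.mul_sum]
  ring

/-- `κᵢ² + σᵢ² = a² + b² = N²R²` — the squared modulus of the rotated order parameter does not depend
on the node. [cite: BronskiDeVillePark2012, §2.2 proof of Lemma 2.4, first display (arXiv:1111.5302 p0007 L88–L97)] -/
theorem rowSum_cos_sq_add_rowSum_sin_sq (θ : Fin n → ℝ) (i : Fin n) :
    (∑ j, Real.cos (θ i - θ j)) ^ 2 + (∑ j, Real.sin (θ i - θ j)) ^ 2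
      = (∑ j, Real.cos (θ j)) ^ 2 + (∑ j, Real.sin (θ j)) ^ 2 := by
  rw [rowSum_cos_eq, rowSum_sin_eq]
  have h := Real.sin_sq_add_cos_sq (θ i)
  linear_combination ((∑ j, Real.cos (θ j)) ^ 2 + (∑ j, Real.sin (θ j)) ^ 2) * h

/-- `κᵢ² + σᵢ² = Σⱼ κⱼ` («`κᵢ² + ωᵢ² = Σⱼ Σⱼ' cos(θⱼ − θⱼ')`», the configuration-space form of
Lemma 2.4 (k1)). [cite: BronskiDeVillePark2012, §2.2 Lemma 2.4, proof, first display (arXiv:1111.5302 p0007 L88–L97)] -/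
theorem rowSum_cos_sq_add_rowSum_sin_sq' (θ : Fin n → ℝ) (i : Fin n) :
    (∑ j, Real.cos (θ i - θ j)) ^ 2 + (∑ j, Real.sin (θ i - θ j)) ^ 2
      = ∑ j, ∑ l, Real.cos (θ j - θ l) := by
  rw [rowSum_cos_sq_add_rowSum_sin_sq, sum_sum_cos_sub_eq]

/-- In the frame where the order parameter is real and positive (`Σ sin θⱼ = 0`, `Σ cos θⱼ > 0`) the
row sum `κᵢ` is `(Σⱼ cos θⱼ)·cos θᵢ`, so `κᵢ < 0` exactly for the phases with `cos θᵢ < 0`: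
`n₊(−D) = #{i : cos θᵢ < 0}`. [cite: BronskiDeVillePark2012, §2.2 Prop. 2.1 (arXiv:1111.5302 p0005 L150–p0006 L12)] -/
theorem rowSum_cos_eq_of_centred {θ : Fin n → ℝ} (hb : ∑ j, Real.sin (θ j) = 0) (i : Fin n) :
    ∑ j, Real.cos (θ i - θ j) = (∑ j, Real.cos (θ j)) * Real.cos (θ i) := by
  rw [rowSum_cos_eq, hb, zero_mul, add_zero]

/-- **Prop. 2.1**: in the frame of a (non-zero) order parameter on the positive real axis, `κᵢ < 0`
iff `cos θᵢ < 0` — «the number of times this is negative is the number of angles in the range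
`(π/2, 3π/2)`». [cite: BronskiDeVillePark2012, §2.2 Prop. 2.1 and proof (arXiv:1111.5302 p0005 L150–p0006 L12)] -/
theorem rowSum_cos_neg_iff_of_centred {θ : Fin n → ℝ} (hb : ∑ j, Real.sin (θ j) = 0)
    (ha : 0 < ∑ j, Real.cos (θ j)) (i : Fin n) :
    ∑ j, Real.cos (θ i - θ j) < 0 ↔ Real.cos (θ i) < 0 := by
  rw [rowSum_cos_eq_of_centred hb, mul_neg_iff]
  constructor
  · rintro (⟨_, h⟩ | ⟨h, _⟩)
    · exact h
    · exact absurd ha (not_lt.2 h.le)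
  · exact fun h => Or.inl ⟨ha, h⟩

/-! ### §2. The Jacobian form as a rank-two perturbation of a diagonal form (BDP eq. (rank2)) -/

/-- **`J = −D + v ⊗ v + w ⊗ w`**: the real quadratic form of `−J(θ)`,
`u ↦ Σᵢ uᵢ Σⱼ cos(θᵢ − θⱼ)(uᵢ − uⱼ)`, equals `Σᵢ κᵢ uᵢ² − (⟨w, u⟩² + ⟨v, u⟩²)` with `wᵢ = cos θᵢ`,
`vᵢ = sin θᵢ`. [cite: BronskiDeVillePark2012, §2.2 eqs. (J), (rank2), (D) (arXiv:1111.5302 p0005 L97–L128)] -/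
theorem allToAll_linForm_eq (θ u : Fin n → ℝ) :
    ∑ i, u i * ∑ j, Real.cos (θ i - θ j) * (u i - u j)
      = ∑ i, (∑ j, Real.cos (θ i - θ j)) * u i ^ 2
        - ((∑ i, Real.cos (θ i) * u i) ^ 2 + (∑ i, Real.sin (θ i) * u i) ^ 2) := by
  have h1 : ∀ i, u i * ∑ j, Real.cos (θ i - θ j) * (u i - u j)
      = (∑ j, Real.cos (θ i - θ j)) * u i ^ 2
        - ∑ j, (Real.cos (θ i) * u i * (Real.cos (θ j) * u j)
          + Real.sin (θ i) * u i * (Real.sin (θ j) * u j)) := by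
    intro i
    rw [Finset.sum_mul, Finset.mul_sum, ← Finset.sum_sub_distrib]
    refine Finset.sum_congr rfl fun j _ => ?_
    rw [Real.cos_sub]
    ring
  rw [Finset.sum_congr rfl fun i _ => h1 i, Finset.sum_sub_distrib]
  congr 1
  rw [sq, sq, Finset.sum_mul_sum, Finset.sum_mul_sum, ← Finset.sum_add_distrib]
  exact Finset.sum_congr rfl fun i _ => by rw [← Finset.sum_add_distrib]

/-- **The form multiplied by `N²R² = Σᵢ κᵢ`, in the rotated coordinates `κ, σ`:**
`(Σκ)·Q(u) = (Σκ)·Σᵢ κᵢ uᵢ² − (Σᵢ κᵢ uᵢ)² − (Σᵢ σᵢ uᵢ)²` (`⟨κ,u⟩² + ⟨σ,u⟩² = (a² + b²)(⟨w,u⟩² + ⟨v,u⟩²)`).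
[cite: BronskiDeVillePark2012, §2.2 eq. (rank2) and Prop. 2.1 (arXiv:1111.5302 p0005–p0006)] -/
theorem allToAll_linForm_mul_eq (θ u : Fin n → ℝ) :
    (∑ i, ∑ j, Real.cos (θ i - θ j)) * ∑ i, u i * ∑ j, Real.cos (θ i - θ j) * (u i - u j)
      = (∑ i, ∑ j, Real.cos (θ i - θ j)) * ∑ i, (∑ j, Real.cos (θ i - θ j)) * u i ^ 2
        - (∑ i, (∑ j, Real.cos (θ i - θ j)) * u i) ^ 2
        - (∑ i, (∑ j, Real.sin (θ i - θ j)) * u i) ^ 2 := by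
  have hK : ∑ i, (∑ j, Real.cos (θ i - θ j)) * u i
      = (∑ j, Real.cos (θ j)) * ∑ i, Real.cos (θ i) * u i
        + (∑ j, Real.sin (θ j)) * ∑ i, Real.sin (θ i) * u i := by
    simp only [rowSum_cos_eq θ]
    rw [Finset.mul_sum, Finset.mul_sum, ← Finset.sum_add_distrib]
    exact Finset.sum_congr rfl fun i _ => by ring
  have hS : ∑ i, (∑ j, Real.sin (θ i - θ j)) * u i
      = (∑ j, Real.cos (θ j)) * ∑ i, Real.sin (θ i) * u i
        - (∑ j, Real.sin (θ j)) * ∑ i, Real.cos (θ i) * u i := by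
    simp only [rowSum_sin_eq θ]
    rw [Finset.mul_sum, Finset.mul_sum, ← Finset.sum_sub_distrib]
    exact Finset.sum_congr rfl fun i _ => by ring
  rw [allToAll_linForm_eq, hK, hS, sum_sum_cos_sub_eq]
  ring

/-- The value of the form at the `i`-th coordinate vector is the diagonal entry `−Jᵢᵢ = κᵢ − 1`
(`= Σ_{k ≠ i} cos(θₖ − θᵢ)`). [cite: BronskiDeVillePark2012, §2.2 eq. (J) (arXiv:1111.5302 p0005 L97–L101)] -/
theorem allToAll_linForm_single (θ : Fin n → ℝ) (i : Fin n) :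
    ∑ m, (if m = i then (1 : ℝ) else 0)
        * ∑ j, Real.cos (θ m - θ j) * ((if m = i then (1 : ℝ) else 0) - (if j = i then 1 else 0))
      = ∑ j, Real.cos (θ i - θ j) - 1 := by
  rw [Finset.sum_eq_single i (fun m _ hmi => by rw [if_neg hmi, zero_mul])
    (fun h => absurd (Finset.mem_univ i) h)]
  rw [if_pos rfl, one_mul]
  simp only [mul_sub, mul_one, Finset.sum_sub_distrib, mul_boole, Finset.sum_ite_eq',
    Finset.mem_univ, if_true, sub_self, Real.cos_zero]

/-- `Σᵢ σᵢ²/κᵢ = (Σκ)·τ − Σκ` with `τ = Σᵢ 1/κᵢ` (from `σᵢ² = Σκ − κᵢ²`).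
[cite: BronskiDeVillePark2012, §2.2 Thm 2.2 eq. (tau) (arXiv:1111.5302 p0006 L22–L28)] -/
theorem sum_rowSum_sin_sq_div_eq (θ : Fin n → ℝ) (hκ : ∀ i, ∑ j, Real.cos (θ i - θ j) ≠ 0) :
    ∑ i, (∑ j, Real.sin (θ i - θ j)) ^ 2 / ∑ j, Real.cos (θ i - θ j)
      = (∑ i, ∑ j, Real.cos (θ i - θ j)) * (∑ i, 1 / ∑ j, Real.cos (θ i - θ j))
        - ∑ i, ∑ j, Real.cos (θ i - θ j) := by
  rw [Finset.mul_sum, ← Finset.sum_sub_distrib]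
  refine Finset.sum_congr rfl fun i _ => ?_
  have h5 := rowSum_cos_sq_add_rowSum_sin_sq' θ i
  rw [eq_sub_iff_add_eq, div_add' _ _ _ (hκ i), mul_one_div, div_eq_div_iff (hκ i) (hκ i)]
  rw [← h5]
  ring

/-- **Weighted Cauchy–Schwarz in the `κ`-metric**: `⟨σ, v⟩² ≤ (Σᵢ σᵢ²/κᵢ)·(Σᵢ κᵢ vᵢ²)` for `κᵢ > 0`
(`⟨v, D⁻¹v⟩`-type quantities of the rank-two perturbation formula). [cite: BronskiDeVillePark2012, §2.2 Thm 2.2, proof (arXiv:1111.5302 p0006 L30–L100)] -/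
theorem sq_sum_rowSum_sin_mul_le {θ : Fin n → ℝ} (hκ : ∀ i, 0 < ∑ j, Real.cos (θ i - θ j))
    (v : Fin n → ℝ) :
    (∑ i, (∑ j, Real.sin (θ i - θ j)) * v i) ^ 2
      ≤ (∑ i, (∑ j, Real.sin (θ i - θ j)) ^ 2 / ∑ j, Real.cos (θ i - θ j))
        * ∑ i, (∑ j, Real.cos (θ i - θ j)) * v i ^ 2 := by
  have h := Finset.sum_mul_sq_le_sq_mul_sq Finset.univ
    (fun i => (∑ j, Real.sin (θ i - θ j)) / Real.sqrt (∑ j, Real.cos (θ i - θ j)))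
    (fun i => Real.sqrt (∑ j, Real.cos (θ i - θ j)) * v i)
  have e1 : ∀ i, (∑ j, Real.sin (θ i - θ j)) / Real.sqrt (∑ j, Real.cos (θ i - θ j))
      * (Real.sqrt (∑ j, Real.cos (θ i - θ j)) * v i) = (∑ j, Real.sin (θ i - θ j)) * v i := by
    intro i
    have hs : Real.sqrt (∑ j, Real.cos (θ i - θ j)) ≠ 0 := (Real.sqrt_pos.2 (hκ i)).ne'
    field_simp
  have e2 : ∀ i, ((∑ j, Real.sin (θ i - θ j)) / Real.sqrt (∑ j, Real.cos (θ i - θ j))) ^ 2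
      = (∑ j, Real.sin (θ i - θ j)) ^ 2 / ∑ j, Real.cos (θ i - θ j) := by
    intro i
    rw [div_pow, Real.sq_sqrt (hκ i).le]
  have e3 : ∀ i, (Real.sqrt (∑ j, Real.cos (θ i - θ j)) * v i) ^ 2
      = (∑ j, Real.cos (θ i - θ j)) * v i ^ 2 := by
    intro i
    rw [mul_pow, Real.sq_sqrt (hκ i).le]
  simp only [e1, e2, e3] at h
  exact h

/-- **Centring along the synchronous direction**: with `m = ⟨κ,u⟩/Σκ` and `v = u − m𝟙`,
`(Σκ)·Q(u) = (Σκ)·Σᵢ κᵢ vᵢ² − ⟨σ, v⟩²` (the form is invariant under `u ↦ u + t𝟙`; `⟨κ, v⟩ = 0`,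
`Σσ = 0`). [cite: BronskiDeVillePark2012, §2.2 Thm 2.2 (arXiv:1111.5302 p0006)] -/
theorem allToAll_linForm_centred_eq (θ u : Fin n → ℝ) (hR : ∑ i, ∑ j, Real.cos (θ i - θ j) ≠ 0) :
    (∑ i, ∑ j, Real.cos (θ i - θ j)) * ∑ i, u i * ∑ j, Real.cos (θ i - θ j) * (u i - u j)
      = (∑ i, ∑ j, Real.cos (θ i - θ j))
          * ∑ i, (∑ j, Real.cos (θ i - θ j))
            * (u i - (∑ l, (∑ j, Real.cos (θ l - θ j)) * u l) / ∑ l, ∑ j, Real.cos (θ l - θ j)) ^ 2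
        - (∑ i, (∑ j, Real.sin (θ i - θ j))
            * (u i - (∑ l, (∑ j, Real.cos (θ l - θ j)) * u l) / ∑ l, ∑ j, Real.cos (θ l - θ j))) ^ 2 := by
  rw [allToAll_linForm_mul_eq]
  set R2 := ∑ i, ∑ j, Real.cos (θ i - θ j) with hR2
  set K := ∑ l, (∑ j, Real.cos (θ l - θ j)) * u l with hKdef
  set m := K / R2 with hm
  have hσ0 : ∑ i, ∑ j, Real.sin (θ i - θ j) = 0 := sum_rowSum_sin_eq_zero θ
  have e1 : ∑ i, (∑ j, Real.sin (θ i - θ j)) * (u i - m)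
      = ∑ i, (∑ j, Real.sin (θ i - θ j)) * u i - m * ∑ i, ∑ j, Real.sin (θ i - θ j) := by
    rw [Finset.mul_sum, ← Finset.sum_sub_distrib]
    exact Finset.sum_congr rfl fun i _ => by ring
  have e2 : ∑ i, (∑ j, Real.cos (θ i - θ j)) * (u i - m) ^ 2
      = ∑ i, (∑ j, Real.cos (θ i - θ j)) * u i ^ 2 - 2 * m * K + m ^ 2 * R2 := by
    rw [hKdef, hR2, Finset.mul_sum, Finset.mul_sum, ← Finset.sum_sub_distrib,
      ← Finset.sum_add_distrib]
    exact Finset.sum_congr rfl fun i _ => by ring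
  have hmR : m * R2 = K := div_mul_cancel₀ K hR
  rw [e1, e2, hσ0, mul_zero, sub_zero]
  have hK' : K = m * R2 := hmR.symm
  rw [hK']
  ring

/-! ### §3. THE CRITERION (BDP Theorem 2.2 with `n₊(J) = 0`, Def. 2.4, Remark 2.2) -/

/-- **The form at the witness `u* = σ/κ`** (the direction `D⁻¹v` of the rank-two formula):
`(Σκ)·Q(σ/κ) = T·(Σκ − T)` with `T = Σᵢ σᵢ²/κᵢ`. [cite: BronskiDeVillePark2012, §2.2 Thm 2.2, proof, eq. (x) «`x = η(⟨v,x⟩D⁻¹v + ⟨w,x⟩D⁻¹w)`» (arXiv:1111.5302 p0006 L44–L60)] -/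
theorem allToAll_linForm_witness_eq (θ : Fin n → ℝ) (hκ : ∀ i, ∑ j, Real.cos (θ i - θ j) ≠ 0) :
    (∑ i, ∑ j, Real.cos (θ i - θ j))
        * ∑ i, ((∑ j, Real.sin (θ i - θ j)) / ∑ j, Real.cos (θ i - θ j))
          * ∑ j, Real.cos (θ i - θ j)
            * ((∑ l, Real.sin (θ i - θ l)) / (∑ l, Real.cos (θ i - θ l))
              - (∑ l, Real.sin (θ j - θ l)) / ∑ l, Real.cos (θ j - θ l))
      = (∑ i, (∑ j, Real.sin (θ i - θ j)) ^ 2 / ∑ j, Real.cos (θ i - θ j))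
        * (∑ i, ∑ j, Real.cos (θ i - θ j)
          - ∑ i, (∑ j, Real.sin (θ i - θ j)) ^ 2 / ∑ j, Real.cos (θ i - θ j)) := by
  rw [allToAll_linForm_mul_eq]
  have e1 : ∑ i, (∑ j, Real.cos (θ i - θ j))
      * ((∑ j, Real.sin (θ i - θ j)) / ∑ j, Real.cos (θ i - θ j)) ^ 2
      = ∑ i, (∑ j, Real.sin (θ i - θ j)) ^ 2 / ∑ j, Real.cos (θ i - θ j) := by
    refine Finset.sum_congr rfl fun i _ => ?_
    field_simp [hκ i]
  have e2 : ∑ i, (∑ j, Real.cos (θ i - θ j))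
      * ((∑ j, Real.sin (θ i - θ j)) / ∑ j, Real.cos (θ i - θ j))
      = ∑ i, ∑ j, Real.sin (θ i - θ j) := by
    refine Finset.sum_congr rfl fun i _ => ?_
    rw [mul_div_cancel₀ _ (hκ i)]
  have e3 : ∑ i, (∑ j, Real.sin (θ i - θ j))
      * ((∑ j, Real.sin (θ i - θ j)) / ∑ j, Real.cos (θ i - θ j))
      = ∑ i, (∑ j, Real.sin (θ i - θ j)) ^ 2 / ∑ j, Real.cos (θ i - θ j) := by
    refine Finset.sum_congr rfl fun i _ => ?_
    rw [sq, mul_div_assoc]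
  rw [e1, e2, e3, sum_rowSum_sin_eq_zero]
  ring

/-- ★ **BDP Theorem 2.2, the stable case, sufficiency half: `κᵢ > 0` for all `i` and
`τ = Σᵢ 1/κᵢ ≤ 2` ⇒ the Jacobian form is negative semi-definite** (`Q(u) ≥ 0` for every real `u`;
all-to-all uniform coupling, ANY configuration `θ`, no hypothesis on the natural frequencies).
Route: centring + weighted Cauchy–Schwarz, `(Σκ)Q(u) ≥ (Σκ − T)Σκᵢvᵢ² ≥ 0` with `T = (Σκ)(τ − 1)`.
[cite: BronskiDeVillePark2012, §2.2 Theorem 2.2 eq. (index) with Prop. 2.1, and Def. 2.4 / Remark 2.2 («`S_ω` is precisely the set of `ω = f(θ)` … the Jacobian (rank2) is negative semi-definite») (arXiv:1111.5302 p0006 L22–L100, p0007 L44–L54)] -/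
theorem allToAll_linForm_nonneg_of_tau_le_two {θ : Fin n → ℝ}
    (hκ : ∀ i, 0 < ∑ j, Real.cos (θ i - θ j))
    (hτ : ∑ i, 1 / ∑ j, Real.cos (θ i - θ j) ≤ 2) (u : Fin n → ℝ) :
    0 ≤ ∑ i, u i * ∑ j, Real.cos (θ i - θ j) * (u i - u j) := by
  rcases isEmpty_or_nonempty (Fin n) with hn | hn
  · simp
  have hR : 0 < ∑ i, ∑ j, Real.cos (θ i - θ j) :=
    Finset.sum_pos (fun i _ => hκ i) Finset.univ_nonempty
  have hT := sum_rowSum_sin_sq_div_eq θ fun i => (hκ i).ne'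
  have hTle : ∑ i, (∑ j, Real.sin (θ i - θ j)) ^ 2 / ∑ j, Real.cos (θ i - θ j)
      ≤ ∑ i, ∑ j, Real.cos (θ i - θ j) := by
    rw [hT]
    nlinarith [mul_le_mul_of_nonneg_left hτ hR.le]
  have key := allToAll_linForm_centred_eq θ u hR.ne'
  set m := (∑ l, (∑ j, Real.cos (θ l - θ j)) * u l) / ∑ l, ∑ j, Real.cos (θ l - θ j) with hm
  have hCS := sq_sum_rowSum_sin_mul_le hκ (fun i => u i - m)
  have hv : 0 ≤ ∑ i, (∑ j, Real.cos (θ i - θ j)) * (u i - m) ^ 2 :=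
    Finset.sum_nonneg fun i _ => mul_nonneg (hκ i).le (sq_nonneg _)
  have h2 := mul_le_mul_of_nonneg_right hTle hv
  have h3 : 0 ≤ (∑ i, ∑ j, Real.cos (θ i - θ j))
      * ∑ i, u i * ∑ j, Real.cos (θ i - θ j) * (u i - u j) := by
    rw [key]
    linarith
  exact (mul_nonneg_iff_of_pos_left hR).1 h3

/-- ★ **The kernel for `τ < 2` is the synchronous direction only**: `κᵢ > 0`, `τ < 2`, `Q(u) = 0`
⇒ `u` is constant («negative semi-definite with a one dimensional kernel», Def. 2.1; `τ < 2` is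
(k3) of Lemma 2.4). [cite: BronskiDeVillePark2012, §2.1 Definition 2.1, §2.2 Theorem 2.2 and Lemma 2.4 (k2)–(k3) (arXiv:1111.5302 p0005 L44–L52, p0006 L22–L28, p0007 L62–L70)] -/
theorem allToAll_linForm_ker_of_tau_lt_two {θ : Fin n → ℝ}
    (hκ : ∀ i, 0 < ∑ j, Real.cos (θ i - θ j))
    (hτ : ∑ i, 1 / ∑ j, Real.cos (θ i - θ j) < 2) {u : Fin n → ℝ}
    (hu : ∑ i, u i * ∑ j, Real.cos (θ i - θ j) * (u i - u j) = 0) :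
    ∃ a : ℝ, u = fun _ => a := by
  rcases isEmpty_or_nonempty (Fin n) with hn | hn
  · exact ⟨0, funext fun i => (IsEmpty.false i).elim⟩
  have hR : 0 < ∑ i, ∑ j, Real.cos (θ i - θ j) :=
    Finset.sum_pos (fun i _ => hκ i) Finset.univ_nonempty
  have hT := sum_rowSum_sin_sq_div_eq θ fun i => (hκ i).ne'
  have hTlt : ∑ i, (∑ j, Real.sin (θ i - θ j)) ^ 2 / ∑ j, Real.cos (θ i - θ j)
      < ∑ i, ∑ j, Real.cos (θ i - θ j) := by
    rw [hT]
    nlinarith [mul_lt_mul_of_pos_left hτ hR]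
  have key := allToAll_linForm_centred_eq θ u hR.ne'
  set m := (∑ l, (∑ j, Real.cos (θ l - θ j)) * u l) / ∑ l, ∑ j, Real.cos (θ l - θ j) with hm
  have hCS := sq_sum_rowSum_sin_mul_le hκ (fun i => u i - m)
  have hv : 0 ≤ ∑ i, (∑ j, Real.cos (θ i - θ j)) * (u i - m) ^ 2 :=
    Finset.sum_nonneg fun i _ => mul_nonneg (hκ i).le (sq_nonneg _)
  rw [hu, mul_zero] at key
  -- `(Σκ − T)·Σκᵢvᵢ² ≤ 0`, hence `Σκᵢvᵢ² = 0`
  have hv0 : ∑ i, (∑ j, Real.cos (θ i - θ j)) * (u i - m) ^ 2 = 0 := by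
    by_contra hne
    have hpos : 0 < ∑ i, (∑ j, Real.cos (θ i - θ j)) * (u i - m) ^ 2 := lt_of_le_of_ne hv (Ne.symm hne)
    have h2 := mul_lt_mul_of_pos_right hTlt hpos
    linarith
  have hvi := (Finset.sum_eq_zero_iff_of_nonneg fun i _ => mul_nonneg (hκ i).le (sq_nonneg _)).1 hv0
  refine ⟨m, funext fun i => ?_⟩
  have h := hvi i (Finset.mem_univ i)
  rcases mul_eq_zero.1 h with h | h
  · exact absurd h (hκ i).ne'
  · exact sub_eq_zero.1 (pow_eq_zero_iff two_ne_zero |>.1 h)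

/-- ★ **BDP Theorem 2.2, necessity half (i): a negative semi-definite Jacobian has POSITIVE diagonal
`D`** — indeed `κᵢ ≥ 1` for every `i` (the diagonal entry `−Jᵢᵢ = κᵢ − 1 = Σ_{k≠i} cos(θₖ − θᵢ)` is a
value of the form), so `n₊(−D) = 0`: in the frame of the order parameter every phase lies within a
quarter-turn of `ψ`. [cite: BronskiDeVillePark2012, §2.2 Prop. 2.1 and Theorem 2.2 (arXiv:1111.5302 p0005 L150–p0006 L28); Remark 2.1 (= Mirollo–Strogatz 2005 §4)] -/
theorem one_le_rowSum_cos_of_allToAll_linForm_nonneg {θ : Fin n → ℝ}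
    (h : ∀ u : Fin n → ℝ, 0 ≤ ∑ i, u i * ∑ j, Real.cos (θ i - θ j) * (u i - u j)) (i : Fin n) :
    1 ≤ ∑ j, Real.cos (θ i - θ j) := by
  have h0 := h (fun j => if j = i then (1 : ℝ) else 0)
  rw [allToAll_linForm_single] at h0
  linarith

/-- ★ **BDP Theorem 2.2, necessity half (ii): a negative semi-definite Jacobian has `τ ≤ 2`**
(test the form at `u* = σ/κ`: `(Σκ)Q(u*) = T(Σκ − T) ≥ 0` forces `T ≤ Σκ`, i.e. `τ ≤ 2`).
[cite: BronskiDeVillePark2012, §2.2 Theorem 2.2 eq. (index) («`n₊(J) = n₊(−D) + 1` if `τ > 2`») (arXiv:1111.5302 p0006 L22–L100)] -/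
theorem tau_le_two_of_allToAll_linForm_nonneg {θ : Fin n → ℝ}
    (h : ∀ u : Fin n → ℝ, 0 ≤ ∑ i, u i * ∑ j, Real.cos (θ i - θ j) * (u i - u j)) :
    ∑ i, 1 / ∑ j, Real.cos (θ i - θ j) ≤ 2 := by
  rcases isEmpty_or_nonempty (Fin n) with hn | hn
  · simp
  have hκ : ∀ i, 0 < ∑ j, Real.cos (θ i - θ j) := fun i =>
    lt_of_lt_of_le one_pos (one_le_rowSum_cos_of_allToAll_linForm_nonneg h i)
  have hR : 0 < ∑ i, ∑ j, Real.cos (θ i - θ j) :=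
    Finset.sum_pos (fun i _ => hκ i) Finset.univ_nonempty
  have hT := sum_rowSum_sin_sq_div_eq θ fun i => (hκ i).ne'
  have key := allToAll_linForm_witness_eq θ fun i => (hκ i).ne'
  have h0 := h (fun i => (∑ j, Real.sin (θ i - θ j)) / ∑ j, Real.cos (θ i - θ j))
  have h1 := mul_nonneg hR.le h0
  rw [key] at h1
  by_contra hτ
  push Not at hτ
  have hTgt : ∑ i, ∑ j, Real.cos (θ i - θ j)
      < ∑ i, (∑ j, Real.sin (θ i - θ j)) ^ 2 / ∑ j, Real.cos (θ i - θ j) := by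
    rw [hT]
    nlinarith [mul_lt_mul_of_pos_left hτ hR]
  have h2 : (∑ i, (∑ j, Real.sin (θ i - θ j)) ^ 2 / ∑ j, Real.cos (θ i - θ j))
      * (∑ i, ∑ j, Real.cos (θ i - θ j)
        - ∑ i, (∑ j, Real.sin (θ i - θ j)) ^ 2 / ∑ j, Real.cos (θ i - θ j)) < 0 :=
    mul_neg_of_pos_of_neg (lt_trans hR hTgt) (by linarith)
  linarith

/-- ★★★ **BDP THEOREM 2.2 / DEFINITION 2.4 / REMARK 2.2 — THE CLOSED-FORM STABILITY CRITERION FOR THE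
FINITE-`N` ALL-TO-ALL KURAMOTO MODEL.**  For EVERY configuration `θ` (any `N`, any natural
frequencies — the Jacobian does not see them): the Jacobian `J(θ)` of `θ̇ᵢ = ωᵢ + γ Σⱼ sin(θⱼ − θᵢ)`
is negative semi-definite (`Q(u) = Σᵢ uᵢ Σⱼ cos(θᵢ − θⱼ)(uᵢ − uⱼ) ≥ 0` for all real `u`) **if and
only if** `κᵢ(θ) = Σⱼ cos(θⱼ − θᵢ) > 0` for every `i` AND `τ(θ) = Σᵢ 1/κᵢ(θ) ≤ 2`.  (Printed:
`n₊(J) = n₊(−D) + [τ > 2]`, `n₊(−D) = #{κᵢ < 0}`; `𝒮_θ := {κᵢ ≥ 0, τ ≤ 2}` «is precisely» the set of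
configurations with `J` NSD. The boundary value `κᵢ = 0` is excluded here, as it must be: then
`−Jᵢᵢ = −1`.) [cite: BronskiDeVillePark2012, §2.2 Theorem 2.2, Prop. 2.1, Definition 2.4 and Remark 2.2 (arXiv:1111.5302 p0005 L150–p0006 L100, p0007 L44–L54)] -/
theorem allToAll_linForm_nonneg_iff (θ : Fin n → ℝ) :
    (∀ u : Fin n → ℝ, 0 ≤ ∑ i, u i * ∑ j, Real.cos (θ i - θ j) * (u i - u j))
      ↔ (∀ i, 0 < ∑ j, Real.cos (θ i - θ j)) ∧ ∑ i, 1 / ∑ j, Real.cos (θ i - θ j) ≤ 2 :=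
  ⟨fun h => ⟨fun i => lt_of_lt_of_le one_pos (one_le_rowSum_cos_of_allToAll_linForm_nonneg h i),
    tau_le_two_of_allToAll_linForm_nonneg h⟩,
    fun h => allToAll_linForm_nonneg_of_tau_le_two h.1 h.2⟩

/-- ★★ **The STRICT criterion = the interior `𝒮_θ` (Def. 2.1: NSD with one-dimensional kernel;
Lemma 2.4 (k2) `κᵢ > 0`, (k3) `Σ 1/κᵢ < 2`)**: the form is `≥ 0` with kernel EXACTLY the constants
iff `κᵢ > 0` for all `i` and `τ < 2`. (At `τ = 2` the witness `σ/κ` is a second kernel vector.)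
[cite: BronskiDeVillePark2012, §2.1 Definition 2.1, §2.2 Theorem 2.2, Lemma 2.4 (k2)–(k3) (arXiv:1111.5302 p0005 L44–L52, p0006 L22–L28, p0007 L62–L70)] -/
theorem allToAll_linForm_posDef_iff (θ : Fin n → ℝ) :
    ((∀ u : Fin n → ℝ, 0 ≤ ∑ i, u i * ∑ j, Real.cos (θ i - θ j) * (u i - u j))
      ∧ ∀ u : Fin n → ℝ, ∑ i, u i * ∑ j, Real.cos (θ i - θ j) * (u i - u j) = 0 →
        ∃ a : ℝ, u = fun _ => a)
      ↔ (∀ i, 0 < ∑ j, Real.cos (θ i - θ j)) ∧ ∑ i, 1 / ∑ j, Real.cos (θ i - θ j) < 2 := by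
  constructor
  · rintro ⟨h, hker⟩
    obtain ⟨hκ, hτ⟩ := (allToAll_linForm_nonneg_iff θ).1 h
    refine ⟨hκ, lt_of_le_of_ne hτ fun hτ2 => ?_⟩
    rcases isEmpty_or_nonempty (Fin n) with hn | hn
    · simp at hτ2
    have hR : 0 < ∑ i, ∑ j, Real.cos (θ i - θ j) :=
      Finset.sum_pos (fun i _ => hκ i) Finset.univ_nonempty
    have hT := sum_rowSum_sin_sq_div_eq θ fun i => (hκ i).ne'
    rw [hτ2] at hT
    have hTeq : ∑ i, (∑ j, Real.sin (θ i - θ j)) ^ 2 / ∑ j, Real.cos (θ i - θ j)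
        = ∑ i, ∑ j, Real.cos (θ i - θ j) := by rw [hT]; ring
    have key := allToAll_linForm_witness_eq θ fun i => (hκ i).ne'
    rw [hTeq, sub_self, mul_zero] at key
    have h0 := (mul_eq_zero.1 key).resolve_left hR.ne'
    obtain ⟨a, ha⟩ := hker _ h0
    -- `σᵢ = a κᵢ` for all `i`, so `Σσ = a Σκ = 0`, `a = 0`, `σ ≡ 0`, `T = 0 ≠ Σκ`
    have hσ : ∀ i, ∑ j, Real.sin (θ i - θ j) = a * ∑ j, Real.cos (θ i - θ j) := by
      intro i
      have h := congr_fun ha i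
      rw [div_eq_iff (hκ i).ne'] at h
      exact h
    have hsum : ∑ i, ∑ j, Real.sin (θ i - θ j) = a * ∑ i, ∑ j, Real.cos (θ i - θ j) := by
      rw [Finset.mul_sum]
      exact Finset.sum_congr rfl fun i _ => hσ i
    rw [sum_rowSum_sin_eq_zero] at hsum
    have ha0 : a = 0 := by
      rcases mul_eq_zero.1 hsum.symm with h | h
      · exact h
      · exact absurd h hR.ne'
    have hT0 : ∑ i, (∑ j, Real.sin (θ i - θ j)) ^ 2 / ∑ j, Real.cos (θ i - θ j) = 0 :=
      Finset.sum_eq_zero fun i _ => by rw [hσ i, ha0]; simp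
    rw [hT0] at hTeq
    exact hR.ne' hTeq.symm
  · rintro ⟨hκ, hτ⟩
    exact ⟨allToAll_linForm_nonneg_of_tau_le_two hκ hτ.le,
      fun u hu => allToAll_linForm_ker_of_tau_lt_two hκ hτ hu⟩

/-- **Corollary (Lemma 2.4, remark after (k4)): inside the strict region every `κᵢ > 1/2`**
(`1/κᵢ < τ < 2`… here from `1/κᵢ ≤ τ`). [cite: BronskiDeVillePark2012, §2.2 Lemma 2.4 («(k2) implies `κᵢ > 1/2` for all `i`») (arXiv:1111.5302 p0007 L72–L73)] -/
theorem rowSum_cos_gt_half_of_tau_lt_two {θ : Fin n → ℝ}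
    (hκ : ∀ i, 0 < ∑ j, Real.cos (θ i - θ j))
    (hτ : ∑ i, 1 / ∑ j, Real.cos (θ i - θ j) < 2) (i : Fin n) :
    1 / 2 < ∑ j, Real.cos (θ i - θ j) := by
  have h1 : 1 / ∑ j, Real.cos (θ i - θ j) ≤ ∑ l, 1 / ∑ j, Real.cos (θ l - θ j) :=
    Finset.single_le_sum (f := fun l => 1 / ∑ j, Real.cos (θ l - θ j))
      (fun l _ => (one_div_pos.2 (hκ l)).le) (Finset.mem_univ i)
  have h2 : 1 / ∑ j, Real.cos (θ i - θ j) < 2 := lt_of_le_of_lt h1 hτ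
  rw [div_lt_iff₀ (hκ i)] at h2
  linarith

/-! ### §4. Uniform complete coupling: the weighted forms of the tree are `k` times `Q` -/

/-- With uniform complete coupling `cᵢⱼ = k` (`i ≠ j`, diagonal `0`) the tree's real Hessian /
Jacobian form `Σᵢ uᵢ Σⱼ cᵢⱼ cos(θᵢ − θⱼ)(uᵢ − uⱼ)` is `k·Q(u)` (the diagonal summand vanishes on both
sides). [cite: BronskiDeVillePark2012, §2.2 eq. (J) (arXiv:1111.5302 p0005 L97–L101)] -/
theorem linForm_complete_eq (c : Fin n → Fin n → ℝ) (hc : ∀ i j, c i j = if i = j then 0 else k)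
    (θ u : Fin n → ℝ) :
    ∑ i, u i * ∑ j, c i j * Real.cos (θ i - θ j) * (u i - u j)
      = k * ∑ i, u i * ∑ j, Real.cos (θ i - θ j) * (u i - u j) := by
  have h : ∀ i, ∑ j, c i j * Real.cos (θ i - θ j) * (u i - u j)
      = k * ∑ j, Real.cos (θ i - θ j) * (u i - u j) := by
    intro i
    rw [Finset.mul_sum]
    refine Finset.sum_congr rfl fun j _ => ?_
    rw [hc]
    by_cases hij : i = j
    · subst hij; simp
    · rw [if_neg hij]; ring
  rw [Finset.mul_sum]
  exact Finset.sum_congr rfl fun i _ => by rw [h i]; ring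

/-- The real Hessian form of the swing model equals one half of the symmetric sum of squares:
`Σᵢ vᵢ Σⱼ cᵢⱼ cos(θᵢ − θⱼ)(vᵢ − vⱼ) = ½ Σᵢ Σⱼ cᵢⱼ cos(θᵢ − θⱼ)(vᵢ − vⱼ)²` for symmetric `c`
(private helper). [folklore] -/
private theorem linForm_eq_half_sum_sq (c : Fin n → Fin n → ℝ) (hc : ∀ i j, c i j = c j i)
    (θ v : Fin n → ℝ) :
    ∑ i, v i * ∑ j, c i j * Real.cos (θ i - θ j) * (v i - v j)
      = 1 / 2 * ∑ i, ∑ j, c i j * Real.cos (θ i - θ j) * (v i - v j) ^ 2 := by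
  have hw : ∀ i j, c j i * Real.cos (θ j - θ i) = c i j * Real.cos (θ i - θ j) := by
    intro i j
    rw [hc j i, ← Real.cos_neg, neg_sub]
  have h1 : ∑ i, v i * ∑ j, c i j * Real.cos (θ i - θ j) * (v i - v j)
      = ∑ i, ∑ j, c i j * Real.cos (θ i - θ j) * (v i * (v i - v j)) := by
    refine Finset.sum_congr rfl fun i _ => ?_
    rw [Finset.mul_sum]
    exact Finset.sum_congr rfl fun j _ => by ring
  have h2 : ∑ i, ∑ j, c i j * Real.cos (θ i - θ j) * (v i * (v i - v j))
      = ∑ i, ∑ j, c i j * Real.cos (θ i - θ j) * (v j * (v j - v i)) := by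
    rw [Finset.sum_comm]
    exact Finset.sum_congr rfl fun i _ => Finset.sum_congr rfl fun j _ => by rw [hw]
  have h3 : ∑ i, ∑ j, c i j * Real.cos (θ i - θ j) * (v i - v j) ^ 2
      = ∑ i, ∑ j, c i j * Real.cos (θ i - θ j) * (v i * (v i - v j))
        + ∑ i, ∑ j, c i j * Real.cos (θ i - θ j) * (v j * (v j - v i)) := by
    rw [← Finset.sum_add_distrib]
    refine Finset.sum_congr rfl fun i _ => ?_
    rw [← Finset.sum_add_distrib]
    exact Finset.sum_congr rfl fun j _ => by ring
  rw [h1, h3, ← h2]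
  ring

/-- Uniform complete coupling is symmetric (private helper). [folklore] -/
private theorem complete_weights_symm (c : Fin n → Fin n → ℝ) (hc : ∀ i j, c i j = if i = j then 0 else k)
    (i j : Fin n) : c i j = c j i := by
  rw [hc, hc]
  by_cases h : i = j
  · subst h; rfl
  · rw [if_neg h, if_neg (Ne.symm h)]

variable (Kur : NonuniformKuramoto n)

/-- The print's notion «the Jacobian is negative semi-definite» for the stability matrix `−L(θ)` of
the tree (`L(θ)` the state-dependent Laplacian with weights `Pᵢⱼ cos(θᵢ − θⱼ)`) is the
non-negativity of the real form `Σᵢ zᵢ Σⱼ Pᵢⱼ cos(θᵢ − θⱼ)(zᵢ − zⱼ)`. [cite: BronskiDeVillePark2012, §1 Definition 1.1 and §2.1 Definition 2.1 (arXiv:1111.5302 p0003 L140–p0004 L9, p0005 L44–L52)] -/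
theorem stabilityMatrix_negSemidef_iff_linForm_nonneg (θ : Fin n → ℝ) :
    (∀ z : Fin n → ℝ, z ⬝ᵥ ((-Kur.toDroopNetwork.lap θ) *ᵥ z) ≤ 0)
      ↔ ∀ z : Fin n → ℝ, 0 ≤ ∑ i, z i * ∑ j, Kur.P i j * Real.cos (θ i - θ j) * (z i - z j) := by
  refine forall_congr' fun z => ?_
  rw [Matrix.neg_mulVec, dotProduct_neg, neg_nonpos, Kur.dotProduct_lap_mulVec]
  simp only [toDroopNetwork_linWeight]

/-- «Negative semi-definite with a one dimensional kernel» (the synchronous direction `𝟙`), typed as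
NEGATIVE DEFINITENESS OFF THE CONSTANTS: `zᵀ(−L(θ))z < 0` for every non-constant `z`, is positivity
of the real form off the constants. [cite: BronskiDeVillePark2012, §2.1 Definition 2.1 (arXiv:1111.5302 p0005 L44–L52)] -/
theorem stabilityMatrix_negDef_iff_linForm_pos (θ : Fin n → ℝ) :
    (∀ z : Fin n → ℝ, (¬ ∃ a : ℝ, z = fun _ => a) → z ⬝ᵥ ((-Kur.toDroopNetwork.lap θ) *ᵥ z) < 0)
      ↔ ∀ z : Fin n → ℝ, (¬ ∃ a : ℝ, z = fun _ => a) →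
          0 < ∑ i, z i * ∑ j, Kur.P i j * Real.cos (θ i - θ j) * (z i - z j) := by
  refine forall_congr' fun z => imp_congr_right fun _ => ?_
  rw [Matrix.neg_mulVec, dotProduct_neg, neg_lt_zero, Kur.dotProduct_lap_mulVec]
  simp only [toDroopNetwork_linWeight]

/-! ### §5. THE CRITERION IN THE MODEL: non-uniform Kuramoto oscillators on the uniform complete
network (`Pᵢⱼ = k > 0` for `i ≠ j`, ANY natural frequencies `ω`, any time constants `Dᵢ > 0`) -/

/-- ★★★ **BDP Theorem 2.2 (stable case) in the model, print's notion: for the uniformly all-to-all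
coupled network the stability matrix `−L(θ)` is negative semi-definite at a configuration `θ` IFF
`κᵢ(θ) = Σⱼ cos(θᵢ − θⱼ) > 0` for all `i` and `Σᵢ 1/κᵢ(θ) ≤ 2`** — hypothesis-free in `θ` and in
the natural frequencies. MODEL: first-order (non-uniform) Kuramoto, lossless, `Pᵢⱼ = k` (`i ≠ j`).
[cite: BronskiDeVillePark2012, §2.2 Theorem 2.2, Prop. 2.1, Definition 2.4, Remark 2.2 (arXiv:1111.5302 p0005–p0007)] -/
theorem complete_stabilityMatrix_negSemidef_iff (hk : 0 < k)
    (hP : ∀ i j, Kur.P i j = if i = j then 0 else k) (θ : Fin n → ℝ) :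
    (∀ z : Fin n → ℝ, z ⬝ᵥ ((-Kur.toDroopNetwork.lap θ) *ᵥ z) ≤ 0)
      ↔ (∀ i, 0 < ∑ j, Real.cos (θ i - θ j)) ∧ ∑ i, 1 / ∑ j, Real.cos (θ i - θ j) ≤ 2 := by
  rw [Kur.stabilityMatrix_negSemidef_iff_linForm_nonneg, ← allToAll_linForm_nonneg_iff]
  simp only [linForm_complete_eq k Kur.P hP]
  exact ⟨fun h u => (mul_nonneg_iff_of_pos_left hk).1 (h u), fun h u => mul_nonneg hk.le (h u)⟩

/-- ★★ **The strict criterion in the model: `−L(θ)` is negative definite off the synchronous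
direction IFF `κᵢ(θ) > 0` for all `i` and `Σᵢ 1/κᵢ(θ) < 2`** (`θ ∈ 𝒮_θ`, Def. 2.1 / Lemma 2.4
(k2)–(k3)). [cite: BronskiDeVillePark2012, §2.1 Definition 2.1, §2.2 Theorem 2.2, Lemma 2.4 (arXiv:1111.5302 p0005–p0007)] -/
theorem complete_stabilityMatrix_negDef_iff (hk : 0 < k)
    (hP : ∀ i j, Kur.P i j = if i = j then 0 else k) (θ : Fin n → ℝ) :
    (∀ z : Fin n → ℝ, (¬ ∃ a : ℝ, z = fun _ => a) → z ⬝ᵥ ((-Kur.toDroopNetwork.lap θ) *ᵥ z) < 0)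
      ↔ (∀ i, 0 < ∑ j, Real.cos (θ i - θ j)) ∧ ∑ i, 1 / ∑ j, Real.cos (θ i - θ j) < 2 := by
  rw [Kur.stabilityMatrix_negDef_iff_linForm_pos, ← allToAll_linForm_posDef_iff]
  simp only [linForm_complete_eq k Kur.P hP]
  constructor
  · intro h
    have hnn : ∀ u : Fin n → ℝ, 0 ≤ ∑ i, u i * ∑ j, Real.cos (θ i - θ j) * (u i - u j) := by
      intro u
      by_cases hc : ∃ a : ℝ, u = fun _ => a
      · obtain ⟨a, rfl⟩ := hc
        simp
      · exact ((mul_pos_iff_of_pos_left hk).1 (h u hc)).le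
    refine ⟨hnn, fun u hu => ?_⟩
    by_contra hc
    have h1 := h u hc
    rw [hu, mul_zero] at h1
    exact lt_irrefl _ h1
  · rintro ⟨hnn, hker⟩ u hc
    rcases (hnn u).lt_or_eq with hpos | hzero
    · exact mul_pos hk hpos
    · exact absurd (hker u hzero.symm) hc

/-- ★★ **Lyapunov reading, necessity: a LYAPUNOV-STABLE phase-locked solution of the uniformly
all-to-all coupled network satisfies the criterion** — `κᵢ > 0` for all `i` and `Σᵢ 1/κᵢ ≤ 2`
(heterogeneous `ω`: the locked state rotates at `ω_sync = Σω/ΣD`; «stable» = every motion from every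
state `δ`-close to `θ` stays `ε`-close to the rotating locked solution). Bridge: Lyapunov-stable ⇒
NSD (`stabilityMatrix_negSemidef_of_lockedSolution_stable`, Khalil 4.7 through the tree).
[cite: BronskiDeVillePark2012, §1 Definition 1.1, §2.2 Theorem 2.2 / Remark 2.2 (arXiv:1111.5302 p0003–p0007); Khalil2002, Theorem 4.7] -/
theorem complete_criterion_of_lockedSolution_stable (hD : ∀ i, 0 < Kur.D i) (hk : 0 < k)
    (hP : ∀ i j, Kur.P i j = if i = j then 0 else k) (hφ : ∀ i j, Kur.φ i j = 0)
    {θu : Fin n → ℝ} (hθu : ∀ i, Kur.field θu i = (∑ j, Kur.ω j) / ∑ j, Kur.D j)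
    (hst : ∀ ε > 0, ∃ δ > 0, ∀ x₁ : Fin n → ℝ, ‖x₁ - θu‖ < δ → ∀ θ : ℝ → Fin n → ℝ,
      θ 0 = x₁ → (∀ T : ℝ, ∀ t ∈ Icc 0 T, HasDerivWithinAt θ (Kur.field (θ t)) (Icc 0 T) t) →
      ∀ t, 0 ≤ t → ‖θ t - fun i => θu i + (∑ j, Kur.ω j) / (∑ j, Kur.D j) * t‖ < ε) :
    (∀ i, 0 < ∑ j, Real.cos (θu i - θu j)) ∧ ∑ i, 1 / ∑ j, Real.cos (θu i - θu j) ≤ 2 :=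
  (Kur.complete_stabilityMatrix_negSemidef_iff k hk hP θu).1
    (Kur.stabilityMatrix_negSemidef_of_lockedSolution_stable hD hφ
      (complete_weights_symm k Kur.P hP) hθu hst)

/-- ★★ **Lyapunov reading, sufficiency: the STRICT criterion makes a phase-locked solution locally
exponentially stable modulo the rotation** (`κᵢ > 0`, `Σ 1/κᵢ < 2` ⇒ «asymptotically stable», the
print's Definition 1.1, via the PSD + kernel certificate and MTW Lemma 1 in the tree). `ρ, C, λ`
existential. [cite: BronskiDeVillePark2012, §1 Definition 1.1 and §2.2 Theorem 2.2 (arXiv:1111.5302 p0003 L140–p0004 L9, p0006); ManikTimmeWitthaut2017, §2 Lemma 1] -/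
theorem complete_lockedSolution_locally_expStable_of_tau_lt_two (hD : ∀ i, 0 < Kur.D i)
    (hk : 0 < k) (hP : ∀ i j, Kur.P i j = if i = j then 0 else k) (hφ : ∀ i j, Kur.φ i j = 0)
    {θ₀ : Fin n → ℝ} (hθ₀ : ∀ i, Kur.field θ₀ i = (∑ j, Kur.ω j) / ∑ j, Kur.D j)
    (hκ : ∀ i, 0 < ∑ j, Real.cos (θ₀ i - θ₀ j))
    (hτ : ∑ i, 1 / ∑ j, Real.cos (θ₀ i - θ₀ j) < 2) :
    ∃ ρ > 0, ∃ C > 0, ∃ lam > 0, ∀ (θ : ℝ → Fin n → ℝ) (T : ℝ),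
      (∀ t ∈ Icc 0 T, HasDerivWithinAt θ (Kur.field (θ t)) (Icc 0 T) t) → ‖θ 0 - θ₀‖ < ρ →
      ∀ t ∈ Icc 0 T,
        ‖θ t - fun i => θ₀ i + Kur.D ⬝ᵥ (θ 0 - θ₀) / (∑ i, Kur.D i) + (∑ j, Kur.ω j) / (∑ j, Kur.D j) * t‖
          ≤ C * ‖θ 0 - fun i => θ₀ i + Kur.D ⬝ᵥ (θ 0 - θ₀) / ∑ i, Kur.D i‖ * Real.exp (-lam * t) :=
  Kur.lockedSolution_locally_expStable_of_posCurvature hD hφ (complete_weights_symm k Kur.P hP) hθ₀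
    (fun u => by
      rw [linForm_complete_eq k Kur.P hP]
      exact mul_nonneg hk.le (allToAll_linForm_nonneg_of_tau_le_two hκ hτ.le u))
    (fun u hu => by
      rw [linForm_complete_eq k Kur.P hP] at hu
      exact allToAll_linForm_ker_of_tau_lt_two hκ hτ ((mul_eq_zero.1 hu).resolve_left hk.ne'))

/-- ★★ **… hence LYAPUNOV-STABLE** (the rotating locked solution; `lockedSolution_stable_of_locally_expStable`).
Together with `complete_criterion_of_lockedSolution_stable`: `τ < 2 ⇒` stable `⇒ τ ≤ 2` (with all
`κᵢ > 0`) — the printed region `𝒮_θ` up to its boundary `τ = 2`, where the linearisation is silent.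
[cite: BronskiDeVillePark2012, §2.2 Theorem 2.2, Lemma 2.3 («the region in configuration space where there exists a stable synchronized solution … `τ⁻¹([1,2))`») (arXiv:1111.5302 p0006–p0007)] -/
theorem complete_lockedSolution_stable_of_tau_lt_two (hD : ∀ i, 0 < Kur.D i)
    (hk : 0 < k) (hP : ∀ i j, Kur.P i j = if i = j then 0 else k) (hφ : ∀ i j, Kur.φ i j = 0)
    {θu : Fin n → ℝ} (hθu : ∀ i, Kur.field θu i = (∑ j, Kur.ω j) / ∑ j, Kur.D j)
    (hκ : ∀ i, 0 < ∑ j, Real.cos (θu i - θu j))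
    (hτ : ∑ i, 1 / ∑ j, Real.cos (θu i - θu j) < 2) :
    ∀ ε > 0, ∃ δ > 0, ∀ x₁ : Fin n → ℝ, ‖x₁ - θu‖ < δ → ∀ θ : ℝ → Fin n → ℝ,
      θ 0 = x₁ → (∀ T : ℝ, ∀ t ∈ Icc 0 T, HasDerivWithinAt θ (Kur.field (θ t)) (Icc 0 T) t) →
      ∀ t, 0 ≤ t → ‖θ t - fun i => θu i + (∑ j, Kur.ω j) / (∑ j, Kur.D j) * t‖ < ε :=
  Kur.lockedSolution_stable_of_locally_expStable hD
    (Kur.complete_lockedSolution_locally_expStable_of_tau_lt_two k hD hk hP hφ hθu hκ hτ)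

/-! ### §6. Locked states: Lemma 2.4 (k1) and the sphere containing the stable frequency set -/

/-- At a phase-locked state `θ` of the uniformly all-to-all coupled network rotating at the common
frequency `Ω` (`field θ = Ω𝟙`) the coupling term is the frequency mismatch:
`k σᵢ(θ) = k Σⱼ sin(θᵢ − θⱼ) = ωᵢ − DᵢΩ` («`f(θ) = −ω`»). [cite: BronskiDeVillePark2012, §1 Definition 1.1 eq. (ss) (arXiv:1111.5302 p0003 L140–L147)] -/
theorem complete_locked_rowSum_sin_eq (hD : ∀ i, 0 < Kur.D i)
    (hP : ∀ i j, Kur.P i j = if i = j then 0 else k) (hφ : ∀ i j, Kur.φ i j = 0)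
    {θ : Fin n → ℝ} {Ω : ℝ} (hθ : ∀ i, Kur.field θ i = Ω) (i : Fin n) :
    k * ∑ j, Real.sin (θ i - θ j) = Kur.ω i - Kur.D i * Ω := by
  have h := hθ i
  unfold field at h
  rw [div_eq_iff (hD i).ne'] at h
  have hsum : ∑ j, Kur.P i j * Real.sin (θ i - θ j + Kur.φ i j) = k * ∑ j, Real.sin (θ i - θ j) := by
    rw [Finset.mul_sum]
    refine Finset.sum_congr rfl fun j _ => ?_
    rw [hφ, add_zero, hP]
    by_cases hij : i = j
    · subst hij; simp
    · rw [if_neg hij]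
  rw [hsum] at h
  linarith

/-- ★ **BDP Lemma 2.4 (k1): `κᵢ² + ω̃ᵢ² = Σⱼ κⱼ` at every phase-locked state**, with the scaled
mismatch `ω̃ᵢ = (ωᵢ − DᵢΩ)/k` (printed for `γ = 1`, `Σω = 0`: `κᵢ² + ωᵢ² = Σⱼ κⱼ`).
[cite: BronskiDeVillePark2012, §2.2 Lemma 2.4 eq. (k1) and proof (arXiv:1111.5302 p0007 L62–L97)] -/
theorem complete_locked_sq_identity (hD : ∀ i, 0 < Kur.D i) (hk : k ≠ 0)
    (hP : ∀ i j, Kur.P i j = if i = j then 0 else k) (hφ : ∀ i j, Kur.φ i j = 0)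
    {θ : Fin n → ℝ} {Ω : ℝ} (hθ : ∀ i, Kur.field θ i = Ω) (i : Fin n) :
    (∑ j, Real.cos (θ i - θ j)) ^ 2 + ((Kur.ω i - Kur.D i * Ω) / k) ^ 2
      = ∑ j, ∑ l, Real.cos (θ j - θ l) := by
  rw [← Kur.complete_locked_rowSum_sin_eq k hD hP hφ hθ i, mul_div_cancel_left₀ _ hk]
  exact rowSum_cos_sq_add_rowSum_sin_sq' θ i

/-- ★ **The sphere (Lemma 2.4, display after (k4)): `Σᵢ (κᵢ − N/2)² + Σᵢ ω̃ᵢ² = N³/4` at every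
phase-locked state** (summing (k1) over `i`: `|κ|² + |ω̃|² = N⟨𝟙, κ⟩`; the print's centre `N𝟙` is a
slip for `(N/2)𝟙`). [cite: BronskiDeVillePark2012, §2.2 Lemma 2.4, displays after (k4) (arXiv:1111.5302 p0007 L74–L86)] -/
theorem complete_locked_sphere (hD : ∀ i, 0 < Kur.D i) (hk : k ≠ 0)
    (hP : ∀ i j, Kur.P i j = if i = j then 0 else k) (hφ : ∀ i j, Kur.φ i j = 0)
    {θ : Fin n → ℝ} {Ω : ℝ} (hθ : ∀ i, Kur.field θ i = Ω) :
    ∑ i, (∑ j, Real.cos (θ i - θ j) - n / 2) ^ 2 + ∑ i, ((Kur.ω i - Kur.D i * Ω) / k) ^ 2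
      = (n : ℝ) ^ 3 / 4 := by
  have h1 : ∀ i, ((Kur.ω i - Kur.D i * Ω) / k) ^ 2
      = ∑ j, ∑ l, Real.cos (θ j - θ l) - (∑ j, Real.cos (θ i - θ j)) ^ 2 := by
    intro i
    have h := Kur.complete_locked_sq_identity k hD hk hP hφ hθ i
    linarith
  have h2 : ∀ i, (∑ j, Real.cos (θ i - θ j) - n / 2) ^ 2
      = (∑ j, Real.cos (θ i - θ j)) ^ 2 - n * ∑ j, Real.cos (θ i - θ j) + (n : ℝ) ^ 2 / 4 := by
    intro i; ring
  rw [Finset.sum_congr rfl fun i _ => h1 i, Finset.sum_congr rfl fun i _ => h2 i,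
    Finset.sum_sub_distrib, Finset.sum_add_distrib, Finset.sum_sub_distrib, ← Finset.mul_sum,
    Finset.sum_const, Finset.sum_const, Finset.card_univ, Fintype.card_fin, nsmul_eq_mul,
    nsmul_eq_mul]
  ring

/-- ★ **Corollary: an ℓ²-NECESSARY CONDITION FOR PHASE LOCKING on the uniform complete network —
`Σᵢ (ωᵢ − DᵢΩ)² ≤ k² N³/4`** for every phase-locked state, stable or not («the entire stable region
lies in a sphere of radius `‖ω‖ ≤ N^{3/2}/2`», `γ = 1`). [cite: BronskiDeVillePark2012, §2.2 Lemma 2.4 (arXiv:1111.5302 p0007 L84–L86)] -/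
theorem complete_locked_freq_sq_le (hD : ∀ i, 0 < Kur.D i) (hk : k ≠ 0)
    (hP : ∀ i j, Kur.P i j = if i = j then 0 else k) (hφ : ∀ i j, Kur.φ i j = 0)
    {θ : Fin n → ℝ} {Ω : ℝ} (hθ : ∀ i, Kur.field θ i = Ω) :
    ∑ i, (Kur.ω i - Kur.D i * Ω) ^ 2 ≤ k ^ 2 * (n : ℝ) ^ 3 / 4 := by
  have h := Kur.complete_locked_sphere k hD hk hP hφ hθ
  have h0 : 0 ≤ ∑ i, (∑ j, Real.cos (θ i - θ j) - n / 2) ^ 2 :=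
    Finset.sum_nonneg fun i _ => sq_nonneg _
  have e : ∑ i, ((Kur.ω i - Kur.D i * Ω) / k) ^ 2 = (∑ i, (Kur.ω i - Kur.D i * Ω) ^ 2) / k ^ 2 := by
    rw [Finset.sum_div]
    exact Finset.sum_congr rfl fun i _ => by rw [div_pow]
  rw [e] at h
  have hk2 : 0 < k ^ 2 := by positivity
  have h3 : (∑ i, (Kur.ω i - Kur.D i * Ω) ^ 2) / k ^ 2 ≤ (n : ℝ) ^ 3 / 4 := by linarith
  rw [div_le_iff₀ hk2] at h3
  linarith

/-! ### §7. The classic normalisation `θ̇ᵢ = ωᵢ − (K/N) Σⱼ sin(θᵢ − θⱼ)` (`γ = K/N`, `Dᵢ = 1`) -/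

/-- ★★★ **The criterion for the classic finite-`N` Kuramoto model** (`classic N K ω`: `Dᵢ = 1`,
`Pᵢⱼ = K/N` off the diagonal, arbitrary `ω`), print's notion: `−L(θ)` NSD ⇔ `κᵢ(θ) > 0 ∀ i` and
`Σᵢ 1/κᵢ(θ) ≤ 2`. [cite: BronskiDeVillePark2012, §2.2 Theorem 2.2, Prop. 2.1, Definition 2.4, Remark 2.2 (arXiv:1111.5302 p0005–p0007)] -/
theorem classic_stabilityMatrix_negSemidef_iff {Kc : ℝ} (hKc : 0 < Kc) (hn : 0 < n)
    (ω θ : Fin n → ℝ) :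
    (∀ z : Fin n → ℝ, z ⬝ᵥ ((-(classic n Kc ω).toDroopNetwork.lap θ) *ᵥ z) ≤ 0)
      ↔ (∀ i, 0 < ∑ j, Real.cos (θ i - θ j)) ∧ ∑ i, 1 / ∑ j, Real.cos (θ i - θ j) ≤ 2 :=
  (classic n Kc ω).complete_stabilityMatrix_negSemidef_iff (Kc / (n : ℝ))
    (div_pos hKc (Nat.cast_pos.2 hn)) (fun _ _ => rfl) θ

/-- ★★ **Strict criterion, classic model**: `−L(θ)` negative definite off `𝟙` ⇔ `κᵢ > 0 ∀ i` and
`Σ 1/κᵢ < 2`. [cite: BronskiDeVillePark2012, §2.1 Definition 2.1, §2.2 Theorem 2.2, Lemma 2.4 (arXiv:1111.5302 p0005–p0007)] -/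
theorem classic_stabilityMatrix_negDef_iff {Kc : ℝ} (hKc : 0 < Kc) (hn : 0 < n)
    (ω θ : Fin n → ℝ) :
    (∀ z : Fin n → ℝ, (¬ ∃ a : ℝ, z = fun _ => a) →
        z ⬝ᵥ ((-(classic n Kc ω).toDroopNetwork.lap θ) *ᵥ z) < 0)
      ↔ (∀ i, 0 < ∑ j, Real.cos (θ i - θ j)) ∧ ∑ i, 1 / ∑ j, Real.cos (θ i - θ j) < 2 :=
  (classic n Kc ω).complete_stabilityMatrix_negDef_iff (Kc / (n : ℝ))
    (div_pos hKc (Nat.cast_pos.2 hn)) (fun _ _ => rfl) θ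

/-- ★★ **Classic model, Lyapunov reading**: a Lyapunov-stable locked solution (rotating at the mean
frequency `ω̄ = Σω/N`) has `κᵢ > 0 ∀ i` and `Σ 1/κᵢ ≤ 2`.
[cite: BronskiDeVillePark2012, §1 Definition 1.1, §2.2 Theorem 2.2 / Remark 2.2 (arXiv:1111.5302 p0003–p0007); Khalil2002, Theorem 4.7] -/
theorem classic_criterion_of_lockedSolution_stable {Kc : ℝ} (hKc : 0 < Kc) (hn : 0 < n)
    (ω : Fin n → ℝ) {θu : Fin n → ℝ}
    (hθu : ∀ i, (classic n Kc ω).field θu i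
      = (∑ j, (classic n Kc ω).ω j) / ∑ j, (classic n Kc ω).D j)
    (hst : ∀ ε > 0, ∃ δ > 0, ∀ x₁ : Fin n → ℝ, ‖x₁ - θu‖ < δ → ∀ θ : ℝ → Fin n → ℝ,
      θ 0 = x₁ → (∀ T : ℝ, ∀ t ∈ Icc 0 T,
        HasDerivWithinAt θ ((classic n Kc ω).field (θ t)) (Icc 0 T) t) →
      ∀ t, 0 ≤ t → ‖θ t - fun i => θu i
        + (∑ j, (classic n Kc ω).ω j) / (∑ j, (classic n Kc ω).D j) * t‖ < ε) :
    (∀ i, 0 < ∑ j, Real.cos (θu i - θu j)) ∧ ∑ i, 1 / ∑ j, Real.cos (θu i - θu j) ≤ 2 :=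
  (classic n Kc ω).complete_criterion_of_lockedSolution_stable (Kc / (n : ℝ)) (fun _ => one_pos)
    (div_pos hKc (Nat.cast_pos.2 hn)) (fun _ _ => rfl) (fun _ _ => rfl) hθu hst

/-- ★★ **… and the strict criterion makes a locked solution of the classic model Lyapunov-stable.**
[cite: BronskiDeVillePark2012, §1 Definition 1.1, §2.2 Theorem 2.2 (arXiv:1111.5302 p0003–p0006); ManikTimmeWitthaut2017, §2 Lemma 1] -/
theorem classic_lockedSolution_stable_of_tau_lt_two {Kc : ℝ} (hKc : 0 < Kc) (hn : 0 < n)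
    (ω : Fin n → ℝ) {θu : Fin n → ℝ}
    (hθu : ∀ i, (classic n Kc ω).field θu i
      = (∑ j, (classic n Kc ω).ω j) / ∑ j, (classic n Kc ω).D j)
    (hκ : ∀ i, 0 < ∑ j, Real.cos (θu i - θu j))
    (hτ : ∑ i, 1 / ∑ j, Real.cos (θu i - θu j) < 2) :
    ∀ ε > 0, ∃ δ > 0, ∀ x₁ : Fin n → ℝ, ‖x₁ - θu‖ < δ → ∀ θ : ℝ → Fin n → ℝ,
      θ 0 = x₁ → (∀ T : ℝ, ∀ t ∈ Icc 0 T,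
        HasDerivWithinAt θ ((classic n Kc ω).field (θ t)) (Icc 0 T) t) →
      ∀ t, 0 ≤ t → ‖θ t - fun i => θu i
        + (∑ j, (classic n Kc ω).ω j) / (∑ j, (classic n Kc ω).D j) * t‖ < ε :=
  (classic n Kc ω).complete_lockedSolution_stable_of_tau_lt_two (Kc / (n : ℝ)) (fun _ => one_pos)
    (div_pos hKc (Nat.cast_pos.2 hn)) (fun _ _ => rfl) (fun _ _ => rfl) hθu hκ hτ

/-- ★ **Classic model: every phase-locked state (common frequency `Ω`) has
`Σᵢ (ωᵢ − Ω)² ≤ K² N/4`** — the sphere `‖ω‖ ≤ N^{3/2}/2` of the print for `γ = K/N`.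
[cite: BronskiDeVillePark2012, §2.2 Lemma 2.4 (arXiv:1111.5302 p0007 L84–L86)] -/
theorem classic_locked_freq_sq_le {Kc : ℝ} (hKc : Kc ≠ 0) (hn : 0 < n) (ω : Fin n → ℝ)
    {θ : Fin n → ℝ} {Ω : ℝ} (hθ : ∀ i, (classic n Kc ω).field θ i = Ω) :
    ∑ i, (ω i - Ω) ^ 2 ≤ Kc ^ 2 * n / 4 := by
  have hn' : (n : ℝ) ≠ 0 := (Nat.cast_pos.2 hn).ne'
  have h := (classic n Kc ω).complete_locked_freq_sq_le (Kc / (n : ℝ)) (fun _ => one_pos)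
    (div_ne_zero hKc hn') (fun _ _ => rfl) (fun _ _ => rfl) hθ
  have e : ∀ i, ((classic n Kc ω).ω i - (classic n Kc ω).D i * Ω) = ω i - Ω := by
    intro i
    show ω i - 1 * Ω = ω i - Ω
    ring
  simp only [e] at h
  calc ∑ i, (ω i - Ω) ^ 2 ≤ (Kc / n) ^ 2 * (n : ℝ) ^ 3 / 4 := h
    _ = Kc ^ 2 * n / 4 := by field_simp

end NonuniformKuramoto

/-! ### §8. THE SWING TWIN: the same criterion for the damped second-order (classical) model on the
uniform complete lossless network with heterogeneous injections -/

namespace ClassicalModel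

namespace LosslessSystem

variable {n : ℕ} (S : LosslessSystem n 0) (k : ℝ)

/-- ★★ **A LYAPUNOV-STABLE synchronous solution of the classical swing model on the uniform complete
network (`Cᵢⱼ = k > 0`, `i ≠ j`; any injections `Pᵢ`, `Mᵢ, Dᵢ > 0`; frequency `Ω = ΣP/ΣD`) satisfies
the criterion: `κᵢ(θ) > 0 ∀ i` and `Σᵢ 1/κᵢ(θ) ≤ 2`** (stable ⇒ Hessian form `≥ 0`
(`hessForm_nonneg_of_stable_syncSolution`) `= k·Q`). MODEL: second-order swing equations, lossless,
no infinite bus. [cite: BronskiDeVillePark2012, §2.2 Theorem 2.2 / Remark 2.2 (arXiv:1111.5302 p0006–p0007); ManikTimmeWitthaut2017, §3 Lemma 1 («for both the Kuramoto system and the power grid model»); Khalil2002, Theorem 4.7] -/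
theorem complete_criterion_of_stable_syncSolution (hk : 0 < k)
    (hC : ∀ i j, S.C i j = if i = j then 0 else k) (hM : ∀ i, 0 < S.M i) (hD : ∀ i, 0 < S.D i)
    {θe : Fin n → ℝ} (he : ∀ i, S.P i - S.D i * ((∑ j, S.P j) / ∑ j, S.D j) = S.flow θe i)
    (hst : ∀ ε > 0, ∃ δ > 0, ∀ x₁ : (Fin n → ℝ) × (Fin n → ℝ),
      dist x₁ (θe, fun _ => (∑ j, S.P j) / ∑ j, S.D j) < δ →
      ∀ X : ℝ → (Fin n → ℝ) × (Fin n → ℝ), X 0 = x₁ →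
        (∀ T : ℝ, ∀ t ∈ Icc 0 T, HasDerivWithinAt X (S.field (X t)) (Icc 0 T) t) →
        ∀ t, 0 ≤ t → dist (X t)
          ((fun j => θe j + (∑ j, S.P j) / (∑ j, S.D j) * t), fun _ => (∑ j, S.P j) / ∑ j, S.D j)
            < ε) :
    (∀ i, 0 < ∑ j, Real.cos (θe i - θe j)) ∧ ∑ i, 1 / ∑ j, Real.cos (θe i - θe j) ≤ 2 := by
  have hCs : ∀ i j, S.C i j = S.C j i := NonuniformKuramoto.complete_weights_symm k S.C hC
  refine (NonuniformKuramoto.allToAll_linForm_nonneg_iff θe).1 fun u => ?_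
  have h := S.hessForm_nonneg_of_stable_syncSolution hCs hM hD he hst u
  rw [← NonuniformKuramoto.linForm_eq_half_sum_sq S.C hCs θe u,
    NonuniformKuramoto.linForm_complete_eq k S.C hC] at h
  exact (mul_nonneg_iff_of_pos_left hk).1 h

/-- ★★ **Conversely the STRICT criterion (`κᵢ > 0`, `Σ 1/κᵢ < 2`) makes the synchronous solution of
the swing model LYAPUNOV-STABLE and attracting in the co-rotating frame** (motions exist; every
motion from a `δ`-close state stays `ε`-close and converges to a point of the synchronous manifold):
the Hessian form is positive off the constants, `stable_syncSolution_of_hessForm_posDef`.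
[cite: BronskiDeVillePark2012, §2.2 Theorem 2.2 (arXiv:1111.5302 p0006); ManikTimmeWitthaut2017, §3 Lemma 1 and Cor. 1] -/
theorem complete_stable_syncSolution_of_tau_lt_two (hk : 0 < k)
    (hC : ∀ i j, S.C i j = if i = j then 0 else k) (hM : ∀ i, 0 < S.M i) (hD : ∀ i, 0 < S.D i)
    {θe : Fin n → ℝ} (he : ∀ i, S.P i - S.D i * ((∑ j, S.P j) / ∑ j, S.D j) = S.flow θe i)
    (hκ : ∀ i, 0 < ∑ j, Real.cos (θe i - θe j))
    (hτ : ∑ i, 1 / ∑ j, Real.cos (θe i - θe j) < 2) {ε : ℝ} (hε : 0 < ε) :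
    ∃ δ > 0, ∀ x₁ : (Fin n → ℝ) × (Fin n → ℝ),
      dist x₁ (θe, fun _ => (∑ j, S.P j) / ∑ j, S.D j) < δ →
      (∃ X : ℝ → (Fin n → ℝ) × (Fin n → ℝ), X 0 = x₁ ∧
          ∀ T : ℝ, ∀ t ∈ Icc 0 T, HasDerivWithinAt X (S.field (X t)) (Icc 0 T) t) ∧
        ∀ X : ℝ → (Fin n → ℝ) × (Fin n → ℝ), X 0 = x₁ →
          (∀ T : ℝ, ∀ t ∈ Icc 0 T, HasDerivWithinAt X (S.field (X t)) (Icc 0 T) t) →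
          ∀ t, 0 ≤ t → dist ((fun j => (X t).1 j - (∑ j, S.P j) / (∑ j, S.D j) * t),
              (fun j => (X t).2 j - (∑ j, S.P j) / ∑ j, S.D j)) (θe, 0) < ε := by
  have hCs : ∀ i j, S.C i j = S.C j i := NonuniformKuramoto.complete_weights_symm k S.C hC
  have hpos : ∀ v : Fin n → ℝ, (∃ i j, v i ≠ v j) →
      0 < 1 / 2 * ∑ i, ∑ j, S.C i j * Real.cos (θe i - θe j) * (v i - v j) ^ 2 := by
    intro v hv
    rw [← NonuniformKuramoto.linForm_eq_half_sum_sq S.C hCs θe v,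
      NonuniformKuramoto.linForm_complete_eq k S.C hC]
    refine mul_pos hk ((NonuniformKuramoto.allToAll_linForm_nonneg_of_tau_le_two hκ hτ.le v).lt_of_ne
      fun h0 => ?_)
    obtain ⟨a, ha⟩ := NonuniformKuramoto.allToAll_linForm_ker_of_tau_lt_two hκ hτ h0.symm
    obtain ⟨i, j, hij⟩ := hv
    exact hij (by rw [ha])
  obtain ⟨δ, hδ, h⟩ := S.stable_syncSolution_of_hessForm_posDef hCs hM hD he hpos hε
  exact ⟨δ, hδ, fun x₁ hx₁ => ⟨(h x₁ hx₁).1, fun X hX0 hX t ht => ((h x₁ hx₁).2 X hX0 hX).1 t ht⟩⟩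

end LosslessSystem

end ClassicalModel

end Literature.MathematicalPhysics.PowerSystems

end
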